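import Summits.ValiantsHypothesis.ValiantsHypothesis.Theorems.DefinabilityGapWindowCorner
import HarnessLib

/-!
# Face descent and position collapse for annihilators of the KI generator (sub-road «width», leaf 23704)

Helper file `--supports stmt-ValiantsHypothesis-23704` (`KIPlantedHittingRO`, aside) of route `DefinabilityGap`;
decomposition workshop, lens 5 (hardness–randomness / PIT axis), generation 31. HONEST LABEL: ELEMENTARY ·
new-combination (the general-`Y` scaling engine of `DefinabilityGapTopCorner` + the window identity of
`DefinabilityGapWindowCorner` + strong induction on the total top degree; an all-but-one-position seed substitution) ·
K1-currency (§2–§3: read-once width-2 chains; §4: every annihilator of `G_m`) · 0 S-currency · closes no item ·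
decides NOTHING of `RatioLeaf(m)` / full width-2 read-once hitting / `b ≥ 2` / K2 / `KIAnnihilatorDefinableOnCollapse` /
VP ≠ VNP. `φ := bind₁ (kiPer m)`, `G_m := kiPer m`, `E_c := cellEmb m c`.

* §1 FACE IDENTITY (`corner_eq_window`). For a read-once width-2 chain `D = uᵀ·∏_j M_j(z_{c_j})·v` (distinct blocks)
  and ANY window `W`: if the top window chain `E_W` (live links kept, each frozen link `M_j`, `c_j ∉ W`, replaced by its
  top coefficient matrix `[z^{topDeg M_j}] M_j`) is nonzero, then `E_W` IS the top corner of `D` along the frozen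
  blocks. (`E_W ≠ 0` cannot be dropped: `(1,0)·[[z,1],[0,0]]·[[0,0],[1,0]]·(1,0)ᵀ = 1`, generation 30.)
* §2 ★ FACE DESCENT (`kiPer_window_annihilated`). If `φ D = 0` then `φ E_W = 0` for every window `W` CLOSED under a
  seed set `S` (no live block meets `S`, every frozen block meets `S`) — `DefinabilityGapTopCorner.kiPer_corner_annihilated`
  with `Y := S`, plus §1 (the case `E_W = 0` is trivial). `DefinabilityGapWindowCorner.kiPer_hits_of_window_ne_zero`
  is the co-small case `2·#W < m²` (there `φ E_W = 0` forces `E_W = 0` by the support rung); for a general window the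
  output is an ANNIHILATED chain of smaller total top degree: annihilated read-once chains are CLOSED UNDER SEED WINDOWS.
* §3 ★★ DESCENT INDUCTION (`chainVal_eq_zero_of_descentResidual`). Strong induction on `Σ_j topDeg M_j`: full width-2
  read-once hitting — literally the right-hand side of `DefinabilityGapRatioLeaf.ratioLeaf_iff` — follows from hitting
  the DESCENT-RESIDUAL chains alone: nonzero chains ALL of whose strict seed-closed window chains vanish.
* §4 ★ POSITION COLLAPSE (`kiPer_posCollapse`, general `D`). For each of the `m²` positions `p₀` a seed substitution
  turns every block permanent `G_m(c)` into the single seed `y_{E_c(p₀)}` (`exists_aeval_kiPer_eq_X`); hence every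
  annihilator of `G_m` dies under each of the `m²` renamings `z_c ↦ y_{E_c(p₀)}` — a permanent-free sieve.
RESIDUAL after this file, cell (β″), IDEA-NEEDED and untouched: nonzero read-once width-2 chains whose constant
skeleton stalls on both sides (`DefinabilityGapRegularSkeleton`), all of whose strict seed-closed window chains vanish
(§3) and all of whose `m²` position collapses vanish (§4). Context (not used): a width-2 read-once chain is, up to a
polynomial factor, a product of chains with nonsingular links (Agrawal–Gurjar–Korwar–Saxena, arXiv:1312.1826, §12,
Lemma 40), so by primality of `ker φ` the residual may be taken with nonsingular links.
[cite: KabanetsImpagliazzo2003, Lemma 30] [cite: SahaSaptharishiSaxena2009, Lemma 2.1]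
-/
noncomputable section
set_option linter.dupNamespace false
open MvPolynomial
open Literature.Computability.AlgebraicComplexity
open scoped Polynomial

namespace Summit.ValiantsHypothesis.ValiantsHypothesis.Theorems.DefinabilityGapFaceDescent
open Summit.ValiantsHypothesis.ValiantsHypothesis.Theorems.DefinabilityGapAffineRung
open Summit.ValiantsHypothesis.ValiantsHypothesis.Theorems.DefinabilityGapAxisSubstitution
open Summit.ValiantsHypothesis.ValiantsHypothesis.Theorems.DefinabilityGapZperTransfer
open Summit.ValiantsHypothesis.ValiantsHypothesis.Theorems.DefinabilityGapRatioLeaf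
open Summit.ValiantsHypothesis.ValiantsHypothesis.Theorems.DefinabilityGapRegularSkeleton
open Summit.ValiantsHypothesis.ValiantsHypothesis.Theorems.DefinabilityGapTopCorner
open Summit.ValiantsHypothesis.ValiantsHypothesis.Theorems.DefinabilityGapWindowCorner

variable {m : ℕ}

/-! ## 1. The top window chain is the top corner -/
/-- If the top window chain over `W` is nonzero, every frozen block attains its top degree in `D`. [this file] -/
theorem degreeOf_blk_eq_topDeg_of_window_ne_zero {l : List (W2Link m)} (hl : (l.map W2Link.blk).Nodup)
    (W : Finset (Fin 3 → Fin (qOf m))) {u v : Fin 2 → ℂ}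
    (hE : chainVal ((window W topDeg l).map W2Link.mat) u v ≠ 0) {L : W2Link m} (hL : L ∈ l) (hLW : L.blk ∉ W) :
    degreeOf L.blk (chainVal (l.map W2Link.mat) u v) = topDeg L := by
  obtain ⟨b, hb⟩ := exists_coeff_ne_zero hE
  have hbW : ∀ c, c ∉ W → b c = 0 := fun c hc => by
    by_contra h
    exact hb (coeff_window_eq_zero W topDeg hc l hl u v b h)
  have ha : b + frozenExp W topDeg l ∈ (chainVal (l.map W2Link.mat) u v).support := by
    rw [mem_support_iff, coeff_add_frozenExp W topDeg l hl u v b hbW]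
    exact hb
  refine le_antisymm (degreeOf_blk_le_topDeg hl u v hL) ?_
  have h := monomial_le_degreeOf L.blk ha
  rw [Finsupp.add_apply, hbW _ hLW, zero_add, frozenExp_apply_blk hl hL hLW] at h
  exact h

/-- **FACE IDENTITY**: for distinct blocks, a frozen set `F` = the blocks of the chain off the window `W`, and a NONZERO
top window chain `E_W`, the top corner of `D` along `F` is `E_W`. [this file] -/
theorem corner_eq_window {l : List (W2Link m)} (hl : (l.map W2Link.blk).Nodup) (W F : Finset (Fin 3 → Fin (qOf m)))
    (hFl : ∀ c ∈ F, c ∈ l.map W2Link.blk) (hFW : ∀ c ∈ F, c ∉ W) (hlF : ∀ L ∈ l, L.blk ∉ W → L.blk ∈ F)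
    {u v : Fin 2 → ℂ} (hE : chainVal ((window W topDeg l).map W2Link.mat) u v ≠ 0) :
    corner F (chainVal (l.map W2Link.mat) u v) = chainVal ((window W topDeg l).map W2Link.mat) u v := by
  classical
  have hdeg : ∀ c ∈ F, degreeOf c (chainVal (l.map W2Link.mat) u v) = frozenExp W topDeg l c := by
    intro c hc
    obtain ⟨L, hL, rfl⟩ := List.mem_map.1 (hFl c hc)
    rw [frozenExp_apply_blk hl hL (hFW _ hc)]
    exact degreeOf_blk_eq_topDeg_of_window_ne_zero hl W hE hL (hFW _ hc)
  have hfe : ∀ c, c ∉ F → frozenExp W topDeg l c = 0 := by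
    intro c hc
    by_cases hcl : c ∈ l.map W2Link.blk
    · obtain ⟨L, hL, rfl⟩ := List.mem_map.1 hcl
      have hLW : L.blk ∈ W := by
        by_contra h
        exact hc (hlF L hL h)
      exact frozenExp_apply_of_mem hLW l
    · exact frozenExp_apply_of_notMem hcl
  ext b
  by_cases hbW : ∀ c, c ∉ W → b c = 0
  · have hstrip : stripExp F (b + frozenExp W topDeg l) = b := by
      ext c
      rw [stripExp_apply, Finsupp.add_apply]
      split_ifs with hc
      · exact (hbW c (hFW c hc)).symm
      · rw [hfe c hc, add_zero]
    have hinj : ∀ a ∈ (chainVal (l.map W2Link.mat) u v).support.filter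
        (fun a => ∀ c ∈ F, a c = degreeOf c (chainVal (l.map W2Link.mat) u v)),
        stripExp F a = b → a = b + frozenExp W topDeg l := by
      intro a ha h
      rw [Finset.mem_filter] at ha
      ext c
      rw [Finsupp.add_apply]
      by_cases hc : c ∈ F
      · rw [ha.2 c hc, hdeg c hc, hbW c (hFW c hc), zero_add]
      · have h' := congrArg (fun e : (Fin 3 → Fin (qOf m)) →₀ ℕ => e c) h
        simp only [stripExp_apply, if_neg hc] at h'
        rw [h', hfe c hc, add_zero]
    rw [← coeff_add_frozenExp W topDeg l hl u v b hbW, corner, coeff_sum,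
      Finset.sum_eq_single (b + frozenExp W topDeg l)]
    · rw [coeff_monomial, if_pos hstrip]
    · intro a ha hne
      rw [coeff_monomial, if_neg]
      exact fun h => hne (hinj a ha h)
    · intro hmem
      rw [coeff_monomial, if_pos hstrip]
      by_contra hne
      exact hmem (Finset.mem_filter.2 ⟨mem_support_iff.2 hne, fun c hc => by
        rw [Finsupp.add_apply, hbW c (hFW c hc), zero_add, hdeg c hc]⟩)
  · push Not at hbW
    obtain ⟨c, hcW, hbc⟩ := hbW
    rw [coeff_window_eq_zero W topDeg hcW l hl u v b hbc, corner, coeff_sum]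
    refine Finset.sum_eq_zero fun a ha => ?_
    rw [coeff_monomial, if_neg]
    intro h
    have h' := congrArg (fun e : (Fin 3 → Fin (qOf m)) →₀ ℕ => e c) h
    simp only [stripExp_apply] at h'
    by_cases hcF : c ∈ F
    · rw [if_pos hcF] at h'
      exact hbc h'.symm
    · rw [if_neg hcF] at h'
      have hcl : c ∉ l.map W2Link.blk := fun hcl => by
        obtain ⟨L, hL, rfl⟩ := List.mem_map.1 hcl
        exact hcF (hlF L hL hcW)
      have hac : a c = 0 := by
        by_contra hne
        exact mem_support_iff.1 (Finset.mem_filter.1 ha).1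
          (coeff_eq_zero_of_notMem_vars (not_mem_vars_chainVal hcl u v) hne)
      exact hbc (h'.symm.trans hac)

/-! ## 2. Face descent: annihilated read-once chains are closed under seed windows -/
/-- ★ **FACE DESCENT.** If `φ D = 0` for a read-once width-2 chain `D` (distinct blocks) and the window `W` is closed under
the seed set `S` — no live block of the chain meets `S`, every frozen block of the chain meets `S` — then the top window
chain is annihilated too: `φ E_W = 0`. All `m`, every `W`; for `2·#W < m²` combine with the support rung. [this file] -/
theorem kiPer_window_annihilated (S : Finset (Fin (qOf m) × Fin (qOf m))) (l : List (W2Link m))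
    (hl : (l.map W2Link.blk).Nodup) (W : Finset (Fin 3 → Fin (qOf m)))
    (hlive : ∀ L ∈ l, L.blk ∈ W → ∀ y ∈ S, y ∉ Finset.univ.map (cellEmb m L.blk))
    (hfrozen : ∀ L ∈ l, L.blk ∉ W → ∃ p : Fin m × Fin m, cellEmb m L.blk p ∈ S) (u v : Fin 2 → ℂ)
    (hD : bind₁ (kiPer m) (chainVal (l.map W2Link.mat) u v) = 0) :
    bind₁ (kiPer m) (chainVal ((window W topDeg l).map W2Link.mat) u v) = 0 := by
  classical
  by_cases hE : chainVal ((window W topDeg l).map W2Link.mat) u v = 0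
  · rw [hE, map_zero]
  · obtain ⟨F, hFl, hFW, hlF⟩ : ∃ F : Finset (Fin 3 → Fin (qOf m)), (∀ c ∈ F, c ∈ l.map W2Link.blk) ∧
        (∀ c ∈ F, c ∉ W) ∧ (∀ L ∈ l, L.blk ∉ W → L.blk ∈ F) :=
      ⟨(l.map W2Link.blk).toFinset.filter (fun c => c ∉ W),
        fun c hc => List.mem_toFinset.1 (Finset.mem_filter.1 hc).1, fun c hc => (Finset.mem_filter.1 hc).2,
        fun L hL hW => Finset.mem_filter.2 ⟨List.mem_toFinset.2 (List.mem_map.2 ⟨L, hL, rfl⟩), hW⟩⟩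
    rw [← corner_eq_window hl W F hFl hFW hlF hE]
    refine kiPer_corner_annihilated m S F (fun c hc => ?_) (fun j hj hjF => ?_) hD
    · obtain ⟨L, hL, rfl⟩ := List.mem_map.1 (hFl c hc)
      exact hfrozen L hL (hFW _ hc)
    · have hjl : j ∈ l.map W2Link.blk := by
        by_contra h
        exact not_mem_vars_chainVal h u v hj
      obtain ⟨L, hL, rfl⟩ := List.mem_map.1 hjl
      have hLW : L.blk ∈ W := by
        by_contra h
        exact hjF (hlF L hL h)
      exact hlive L hL hLW

/-- SINGLE-SEED FORM: freezing exactly the links of the chain through one seed cell `a` keeps `φ`-annihilation. [this file] -/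
theorem kiPer_seedWindow_annihilated (a : Fin (qOf m) × Fin (qOf m)) (l : List (W2Link m))
    (hl : (l.map W2Link.blk).Nodup) (u v : Fin 2 → ℂ) (hD : bind₁ (kiPer m) (chainVal (l.map W2Link.mat) u v) = 0) :
    bind₁ (kiPer m) (chainVal ((window ((l.map W2Link.blk).toFinset.filter fun c =>
      a ∉ Finset.univ.map (cellEmb m c)) topDeg l).map W2Link.mat) u v) = 0 := by
  refine kiPer_window_annihilated {a} l hl
    ((l.map W2Link.blk).toFinset.filter fun c => a ∉ Finset.univ.map (cellEmb m c))
    (fun L _ hW y hy => ?_) (fun L hL hW => ?_) u v hD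
  · rw [Finset.mem_singleton] at hy
    rw [hy]
    exact (Finset.mem_filter.1 hW).2
  · have h : a ∈ Finset.univ.map (cellEmb m L.blk) := by
      by_contra h'
      exact hW (Finset.mem_filter.2 ⟨List.mem_toFinset.2 (List.mem_map.2 ⟨L, hL, rfl⟩), h'⟩)
    obtain ⟨p, -, hp⟩ := Finset.mem_map.1 h
    exact ⟨p, Finset.mem_singleton.2 hp⟩

/-! ## 3. The descent induction -/
/-- A coefficient link has top degree `0`. [this file] -/
theorem topDeg_lead (T : ℕ) (L : W2Link m) : topDeg (lead T L) = 0 := by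
  unfold topDeg
  refine Nat.le_zero.1 (Finset.sup_le fun ik _ => ?_)
  show ((L.M.map fun p => Polynomial.C (p.coeff T)) ik.1 ik.2).natDegree ≤ 0
  rw [Matrix.map_apply]
  exact (Polynomial.natDegree_C _).le

/-- Windows do not increase the total top degree. [this file] -/
theorem sum_topDeg_window_le (W : Finset (Fin 3 → Fin (qOf m))) :
    ∀ l : List (W2Link m), ((window W topDeg l).map topDeg).sum ≤ (l.map topDeg).sum
  | [] => le_of_eq (by rw [window_nil])
  | L :: rest => by
    have ih := sum_topDeg_window_le W rest
    rw [window_cons, List.map_cons, List.map_cons, List.sum_cons, List.sum_cons]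
    split_ifs
    · omega
    · rw [topDeg_lead]
      omega

/-- A STRICT window (some frozen link of positive top degree) lowers the total top degree. [this file] -/
theorem sum_topDeg_window_lt (W : Finset (Fin 3 → Fin (qOf m))) :
    ∀ l : List (W2Link m), (∃ L ∈ l, L.blk ∉ W ∧ 0 < topDeg L) →
      ((window W topDeg l).map topDeg).sum < (l.map topDeg).sum
  | [], ⟨_, h, _⟩ => nomatch h
  | L :: rest, ⟨L', hL', hW', hpos⟩ => by
    have ih := sum_topDeg_window_le W rest
    rw [window_cons, List.map_cons, List.map_cons, List.sum_cons, List.sum_cons]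
    rcases List.mem_cons.1 hL' with rfl | hmem
    · rw [if_neg hW', topDeg_lead]
      omega
    · have ih' := sum_topDeg_window_lt W rest ⟨L', hmem, hW', hpos⟩
      split_ifs
      · omega
      · rw [topDeg_lead]
        omega

/-- INDUCTION SOCKET: to hit every read-once width-2 chain it suffices to hit each one GIVEN hitting for all chains of
smaller total top degree (strong induction on `Σ_j topDeg M_j`). [this file] -/
theorem chainVal_eq_zero_of_induction
    (H : ∀ (l : List (W2Link m)), (l.map W2Link.blk).Nodup → ∀ (u v : Fin 2 → ℂ),
      (∀ (l' : List (W2Link m)), (l'.map W2Link.blk).Nodup → (l'.map topDeg).sum < (l.map topDeg).sum →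
        ∀ (u' v' : Fin 2 → ℂ), bind₁ (kiPer m) (chainVal (l'.map W2Link.mat) u' v') = 0 →
          chainVal (l'.map W2Link.mat) u' v' = 0) →
      bind₁ (kiPer m) (chainVal (l.map W2Link.mat) u v) = 0 → chainVal (l.map W2Link.mat) u v = 0) :
    ∀ (l : List (W2Link m)), (l.map W2Link.blk).Nodup → ∀ (u v : Fin 2 → ℂ),
      bind₁ (kiPer m) (chainVal (l.map W2Link.mat) u v) = 0 → chainVal (l.map W2Link.mat) u v = 0 := by
  suffices h : ∀ (n : ℕ) (l : List (W2Link m)), (l.map topDeg).sum = n → (l.map W2Link.blk).Nodup →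
      ∀ (u v : Fin 2 → ℂ), bind₁ (kiPer m) (chainVal (l.map W2Link.mat) u v) = 0 →
        chainVal (l.map W2Link.mat) u v = 0 from
    fun l hl u v hD => h _ l rfl hl u v hD
  intro n
  refine Nat.strong_induction_on n fun n ih => ?_
  intro l hn hl u v hD
  exact H l hl u v (fun l' hl' hlt u' v' h' => ih _ (lt_of_lt_of_eq hlt hn) l' rfl hl' u' v' h') hD

/-- Inside the induction, ★ turns every STRICT seed-closed window of an annihilated chain into a VANISHING window chain.
[this file] -/
theorem window_eq_zero_of_IH (l : List (W2Link m)) (hl : (l.map W2Link.blk).Nodup)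
    (IH : ∀ (l' : List (W2Link m)), (l'.map W2Link.blk).Nodup → (l'.map topDeg).sum < (l.map topDeg).sum →
      ∀ (u' v' : Fin 2 → ℂ), bind₁ (kiPer m) (chainVal (l'.map W2Link.mat) u' v') = 0 →
        chainVal (l'.map W2Link.mat) u' v' = 0)
    (S : Finset (Fin (qOf m) × Fin (qOf m))) (W : Finset (Fin 3 → Fin (qOf m)))
    (hlive : ∀ L ∈ l, L.blk ∈ W → ∀ y ∈ S, y ∉ Finset.univ.map (cellEmb m L.blk))
    (hfrozen : ∀ L ∈ l, L.blk ∉ W → ∃ p : Fin m × Fin m, cellEmb m L.blk p ∈ S)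
    (hstrict : ∃ L ∈ l, L.blk ∉ W ∧ 0 < topDeg L) (u v : Fin 2 → ℂ)
    (hD : bind₁ (kiPer m) (chainVal (l.map W2Link.mat) u v) = 0) :
    chainVal ((window W topDeg l).map W2Link.mat) u v = 0 :=
  IH (window W topDeg l) (by rw [map_blk_window]; exact hl) (sum_topDeg_window_lt W l hstrict) u v
    (kiPer_window_annihilated S l hl W hlive hfrozen u v hD)

/-- ★★ **DESCENT RESIDUAL THEOREM.** Full width-2 read-once hitting for `G_m` (the right-hand side of
`DefinabilityGapRatioLeaf.ratioLeaf_iff`, all `m`) follows from hitting the DESCENT-RESIDUAL chains only: `φ D ≠ 0`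
for every nonzero read-once chain `D` all of whose STRICT seed-closed top window chains vanish. (For `2·#W < m²` a
nonzero window chain already gives `φ D ≠ 0` by `kiPer_hits_of_window_ne_zero`; here the vanishing of the LARGE
windows is what the residual may assume.) Nothing is claimed about the residual class. [this file] -/
theorem chainVal_eq_zero_of_descentResidual
    (H : ∀ (l : List (W2Link m)), (l.map W2Link.blk).Nodup → ∀ (u v : Fin 2 → ℂ),
      chainVal (l.map W2Link.mat) u v ≠ 0 →
      (∀ (S : Finset (Fin (qOf m) × Fin (qOf m))) (W : Finset (Fin 3 → Fin (qOf m))),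
        (∀ L ∈ l, L.blk ∈ W → ∀ y ∈ S, y ∉ Finset.univ.map (cellEmb m L.blk)) →
        (∀ L ∈ l, L.blk ∉ W → ∃ p : Fin m × Fin m, cellEmb m L.blk p ∈ S) →
        (∃ L ∈ l, L.blk ∉ W ∧ 0 < topDeg L) → chainVal ((window W topDeg l).map W2Link.mat) u v = 0) →
      bind₁ (kiPer m) (chainVal (l.map W2Link.mat) u v) ≠ 0) :
    ∀ (l : List (W2Link m)), (l.map W2Link.blk).Nodup → ∀ (u v : Fin 2 → ℂ),
      bind₁ (kiPer m) (chainVal (l.map W2Link.mat) u v) = 0 → chainVal (l.map W2Link.mat) u v = 0 := by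
  refine chainVal_eq_zero_of_induction fun l hl u v IH hD => ?_
  by_contra hD0
  exact H l hl u v hD0 (fun S W hlive hfrozen hstrict => window_eq_zero_of_IH l hl IH S W hlive hfrozen hstrict u v hD) hD

/-! ## 4. Position collapse: a permanent-free sieve on all annihilators -/
/-- **MONOMIAL-SELECTING SEED SUBSTITUTION**: for each position `p₀` there is a substitution of the seeds (the cell at
`p₀` kept, the other cells on the graph of one permutation through `p₀` set to `1`, all remaining seeds to `0`) under
which EVERY block permanent `G_m(c)` becomes the single seed `y_{E_c(p₀)}`. [this file] -/
theorem exists_aeval_kiPer_eq_X (p₀ : Fin m × Fin m) :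
    ∃ f : Fin (qOf m) × Fin (qOf m) → MvPolynomial (Fin (qOf m) × Fin (qOf m)) ℂ,
      ∀ c : Fin 3 → Fin (qOf m), aeval f (kiPer m c) = X (cellEmb m c p₀) := by
  have hfst : ∀ (c : Fin 3 → Fin (qOf m)) (p : Fin m × Fin m),
      (cellEmb m c p).1 = permPad (sq_le_qOf m) p := fun c p => by
    haveI : NeZero (qOf m) := ⟨(qOf_spec m).2.ne_zero⟩
    show (quadDesign m c (permPad (sq_le_qOf m) p)).1 = _
    exact (ZMod.finEquiv (qOf m)).toEquiv.symm_apply_apply (permPad (sq_le_qOf m) p)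
  classical
  obtain ⟨r₀, s₀⟩ := p₀
  obtain ⟨π, hπ⟩ : ∃ π : Equiv.Perm (Fin m), π s₀ = r₀ := ⟨Equiv.swap r₀ s₀, Equiv.swap_apply_right _ _⟩
  obtain ⟨f, hf⟩ : ∃ f : Fin (qOf m) × Fin (qOf m) → MvPolynomial (Fin (qOf m) × Fin (qOf m)) ℂ,
      ∀ (c : Fin 3 → Fin (qOf m)) (ρ : Equiv.Perm (Fin m)) (i : Fin m), f (cellEmb m c (ρ i, i)) =
        if (ρ i, i) = (r₀, s₀) then X (cellEmb m c (r₀, s₀)) else if ρ i = π i then 1 else 0 := by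
    refine ⟨fun x => if x.1 = permPad (sq_le_qOf m) (r₀, s₀) then X x
      else if ∃ j : Fin m, x.1 = permPad (sq_le_qOf m) (π j, j) then 1 else 0, fun c ρ i => ?_⟩
    simp only [hfst]
    by_cases h0 : (ρ i, i) = (r₀, s₀)
    · rw [h0, if_pos rfl, if_pos rfl]
    · rw [if_neg (fun h => h0 ((permPad (sq_le_qOf m)).injective h)), if_neg h0]
      by_cases h1 : ρ i = π i
      · rw [if_pos (show ∃ j : Fin m, permPad (sq_le_qOf m) (ρ i, i) = permPad (sq_le_qOf m) (π j, j)
          from ⟨i, by rw [h1]⟩), if_pos h1]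
      · rw [if_neg, if_neg h1]
        rintro ⟨j, hj⟩
        obtain ⟨h3, h2⟩ := Prod.mk.inj ((permPad (sq_le_qOf m)).injective hj)
        subst h2
        exact h1 h3
  refine ⟨f, fun c => ?_⟩
  rw [aeval_kiPer]
  simp_rw [hf]
  rw [Finset.sum_eq_single π]
  · rw [Finset.prod_eq_single s₀]
    · rw [hπ, if_pos rfl]
    · intro i _ hi
      rw [if_neg (fun h => hi (Prod.mk.inj h).2), if_pos rfl]
    · exact fun h => absurd (Finset.mem_univ _) h
  · intro ρ _ hρ
    obtain ⟨i, hi⟩ : ∃ i, ¬ ρ i = π i := not_forall.1 fun h => hρ (Equiv.ext h)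
    have hne : (ρ i, i) ≠ (r₀, s₀) := fun h => hi (by
      obtain ⟨h3, h2⟩ := Prod.mk.inj h
      rw [h3, h2, hπ])
    refine Finset.prod_eq_zero (Finset.mem_univ i) ?_
    rw [if_neg hne, if_neg hi]
  · exact fun h => absurd (Finset.mem_univ _) h

/-- ★ **POSITION COLLAPSE** (every annihilator, all `m`): if `φ D = 0` then `D` dies under each of the `m²` renamings
`z_c ↦ y_{E_c(p₀)}` of the block variables into the seed ring — `m²` permanent-free necessary conditions; for a
read-once chain: `uᵀ·∏_j M_j(y_{E_{c_j}(p₀)})·v = 0` in `ℂ[y]` for every position `p₀`. [this file] -/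
theorem kiPer_posCollapse (p₀ : Fin m × Fin m) {D : MvPolynomial (Fin 3 → Fin (qOf m)) ℂ}
    (hD : bind₁ (kiPer m) D = 0) :
    aeval (fun c => (X (cellEmb m c p₀) : MvPolynomial (Fin (qOf m) × Fin (qOf m)) ℂ)) D = 0 := by
  obtain ⟨f, hf⟩ := exists_aeval_kiPer_eq_X p₀
  have h := congrArg (aeval f) hD
  rw [map_zero, ← aeval_eq_bind₁, ← AlgHom.comp_apply, comp_aeval] at h
  have hfun : (fun c => aeval f (kiPer m c)) = fun c => (X (cellEmb m c p₀) : MvPolynomial _ ℂ) := funext hf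
  rw [hfun] at h
  exact h

end Summit.ValiantsHypothesis.ValiantsHypothesis.Theorems.DefinabilityGapFaceDescent

end
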